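import Summits.CriticalPhenomena.Ising3D.TaylorCoeffZMonoHalf
import Mathlib.Tactic.Linarith
import Mathlib.Tactic.Ring
import HarnessLib

/-!
# Parity of the Taylor coefficients of `F^s_±[𝒫_{E,j}]` at `(½,½)`: `q² = (-1)^a q¹`, and the vanishing pattern
(cell `pub-ising3x`, seat boot-1; gate (g3): halves the index set of a derivative certificate and matches the
probe's self-check "even derivatives of `F_-` vanish")

HONEST FRAMING: lottery ticket; floor = tightest certified 3D Ising CFT bounds; no exact-solution
claim without a proof.

`qFactor₂ s α a = (-1)^a qFactor₁ s α a` (`qFactor₂_eq`), hence in `taylorCoeffAt_crossF_zMono_half` the bracket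
is `q¹_{p₁}(a) q¹_{p₂}(b) (1 + σ (-1)^{a+b})`: the `(a,b)` Taylor coefficient of `F^s_σ[𝒫_{E,j}]` at `(½,½)`
VANISHES when `σ (-1)^{a+b} = -1` — `F_-` (`σ = -1`): only `a + b` odd survive; `F_+` (`σ = 1`): only `a + b` even
(`taylorCoeffAt_crossF_zMono_half_eq_zero`). (Reflection `z ↦ 1 - z` about the crossing-symmetric point.)
Elementary.
-/

namespace Summit.CriticalPhenomena.Ising3D

open Finset
open Literature.MathematicalPhysics.QuantumFieldTheory.ConformalBootstrap3D

/-- `q²(s,α;a) = (-1)^a q¹(s,α;a)`. [folklore] -/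
theorem qFactor₂_eq (s α : ℝ) (a : ℕ) : qFactor₂ s α a = (-1) ^ a * qFactor₁ s α a := by
  unfold qFactor₁ qFactor₂
  rw [Finset.mul_sum]
  refine Finset.sum_congr rfl fun ij hij => ?_
  have h : ij.1 + ij.2 = a := mem_antidiagonal.mp hij
  have hpow : ((-1 : ℝ) ^ ij.2) = (-1) ^ a * (-1) ^ ij.1 := by
    rw [← h, pow_add]
    have h1 : ((-1 : ℝ) ^ ij.1) * ((-1 : ℝ) ^ ij.1) = 1 := by rw [← mul_pow]; norm_num
    linear_combination (-((-1 : ℝ) ^ ij.2)) * h1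
  rw [hpow]
  ring

/-- **Vanishing pattern.** If `σ (-1)^{a+b} = -1` then `taylorCoeffAt ½ ½ (a,b) (crossF s σ 𝒫_{E,j}) = 0`
(`F_-`: `a+b` even vanish; `F_+`: `a+b` odd vanish). [folklore] -/
theorem taylorCoeffAt_crossF_zMono_half_eq_zero (s σ E : ℝ) (j : ℕ) (hEj : (j : ℝ) ≤ E) (ab : ℕ × ℕ)
    (hσ : σ * (-1) ^ (ab.1 + ab.2) = -1) :
    taylorCoeffAt (1 / 2) (1 / 2) ab (crossF s σ (zMono E j)) = 0 := by
  rw [taylorCoeffAt_crossF_zMono_half s σ E j hEj ab]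
  have hzero : ∀ p ∈ antidiagonal j, legendreLam p.1 * legendreLam p.2 *
      (qFactor₁ s ((E - (j : ℝ)) / 2 + p.1) ab.1 * qFactor₁ s ((E - (j : ℝ)) / 2 + p.2) ab.2 +
        σ * (qFactor₂ s ((E - (j : ℝ)) / 2 + p.1) ab.1 * qFactor₂ s ((E - (j : ℝ)) / 2 + p.2) ab.2)) = 0 := by
    intro p _
    rw [qFactor₂_eq, qFactor₂_eq]
    have : qFactor₁ s ((E - (j : ℝ)) / 2 + p.1) ab.1 * qFactor₁ s ((E - (j : ℝ)) / 2 + p.2) ab.2 +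
        σ * ((-1) ^ ab.1 * qFactor₁ s ((E - (j : ℝ)) / 2 + p.1) ab.1 *
          ((-1) ^ ab.2 * qFactor₁ s ((E - (j : ℝ)) / 2 + p.2) ab.2)) =
        (1 + σ * (-1) ^ (ab.1 + ab.2)) *
          (qFactor₁ s ((E - (j : ℝ)) / 2 + p.1) ab.1 * qFactor₁ s ((E - (j : ℝ)) / 2 + p.2) ab.2) := by
      rw [pow_add]; ring
    rw [this, hσ]
    ring
  rw [Finset.sum_eq_zero hzero, mul_zero]

/-- `F_-`: the coefficients with `a + b` even vanish. [folklore] -/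
theorem taylorCoeffAt_crossF_neg_zMono_half_eq_zero_of_even (s E : ℝ) (j : ℕ) (hEj : (j : ℝ) ≤ E)
    (ab : ℕ × ℕ) (h : Even (ab.1 + ab.2)) :
    taylorCoeffAt (1 / 2) (1 / 2) ab (crossF s (-1) (zMono E j)) = 0 :=
  taylorCoeffAt_crossF_zMono_half_eq_zero s (-1) E j hEj ab (by rw [h.neg_one_pow]; norm_num)

/-- `F_+`: the coefficients with `a + b` odd vanish. [folklore] -/
theorem taylorCoeffAt_crossF_pos_zMono_half_eq_zero_of_odd (s E : ℝ) (j : ℕ) (hEj : (j : ℝ) ≤ E)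
    (ab : ℕ × ℕ) (h : Odd (ab.1 + ab.2)) :
    taylorCoeffAt (1 / 2) (1 / 2) ab (crossF s 1 (zMono E j)) = 0 :=
  taylorCoeffAt_crossF_zMono_half_eq_zero s 1 E j hEj ab (by rw [h.neg_one_pow]; norm_num)

end Summit.CriticalPhenomena.Ising3D
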